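import Mathlib
import Summits.ResolutionOfSingularities.ResolutionOfSingularities.Theorems.WeightedInvariantLocalWeightedDropWildMonicFlagDropSplit
import Summits.ResolutionOfSingularities.ResolutionOfSingularities.Theorems.WeightedInvariantLocalWeightedDropWildMonicFlagN1TermMono
import Summits.ResolutionOfSingularities.ResolutionOfSingularities.Theorems.WeightedInvariantLocalWeightedDropWildMonicWCleanProcess

/-!
# `WeightedInvariant.LocalWeightedDrop`, line `hasse-ridge-face-selection`, S3ρ: `Exit₃` plumbing for the DROP hands — exits from the
# terminal data lemmas, and invariance of `Exit₃` under re-centrings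

Crux item stmt-ResolutionOfSingularities-8899 `LocalWeightedDrop` (route `ResolutionOfSingularities/WeightedInvariant`), engine of the door
`HypersurfaceCentreConstruction` stmt-ResolutionOfSingularities-19897.  [OURS · L1 W4.3, chain w43, res-type-083 (S3ρ first seat, (C9) lead).
Glue between the defs of record of `…WildMonicFlagAssembly` (`IsPos`, `Terminal`, `IsExit`, `Exit₃`) and res-D-pv-056 AS res-L1-w43-stub-5's
point-set readings of Perlega's Lemma 9.1.3 (`termSR_data_of_newtonSet`, `termMono_data_of_newtonSet`).  Not a statement of any manuscript.]

* `exit₃_of_isExit`, `exit₃_of_terminal` — an exit in the CURRENT coordinates is an exit up to free moves (identity moves);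
* `exit₃_shift_iff` — `Exit₃` is invariant under every re-centring `y ↦ y + φ` (`φ(0) = 0`): the hands may clean the child freely
  (stub-3's `subst_shift`, stub-7's `shift_shift`);
* `terminal_of_termSR_shape` / `exit₃_of_termSR_shape` — the SMALL-RESIDUAL point-set shape of the `d!`-scaled Newton set (every point
  has `i`-th coordinate `≥ d!·m`, none sits at `d!·m` on the `i`-axis, some point has total degree `< d!·(m+1)`, `m ≥ 1`) gives
  `Terminal`, hence `Exit₃` at a position [Per17 Lemma 9.1.3, small residual branch];
* `terminal_of_termMono_shape` — the MONOMIAL point-set shape (`deltaL = alphaL = a`, nonempty) together with the non-solvability of the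
  vertex polynomial gives `Terminal` [Per17 Lemma 9.1.3, monomial branch; the non-solvability is the hands' obligation from validity].
-/

set_option linter.dupNamespace false -- mandated namespace of this single-conjunct summit

noncomputable section

namespace Summit.ResolutionOfSingularities.ResolutionOfSingularities.Theorems

open Literature.AlgebraicGeometry.Resolution
open Literature.AlgebraicGeometry.Resolution.HauserPerlega2024 (Triple)

namespace WildMonic

open MvPowerSeries MonicDescent
open PurePowerFlag (swap swapE orient orientE IsN0 IsTangent succE)

variable {k : Type} [Field k] {d p : ℕ}

/-! ### Exits in the current coordinates -/

/-- The identity moves realise the current tuple: `shift d (X^* A) 0 = A`. -/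
theorem shift_subst_X_zero (A : Fin d → MvPowerSeries (Fin 2) k) :
    shift d (fun j => subst (X : Fin 2 → MvPowerSeries (Fin 2) k) (A j)) 0 = A := by
  have hXA : (fun j => subst (X : Fin 2 → MvPowerSeries (Fin 2) k) (A j)) = A := funext fun j => congrFun subst_self (A j)
  rw [hXA, WildMonic.shift_zero]

/-- An exit IN THE CURRENT COORDINATES of a position is an exit up to free moves. -/
theorem exit₃_of_isExit {A : Fin d → MvPowerSeries (Fin 2) k} (hA : IsPos d A) (h : IsExit p d A) : Exit₃ p d A :=
  ⟨X, 0, fun i => constantCoeff_X i, by rw [PurePowerFlag.linMat_X_det]; exact isUnit_one, map_zero _, by rw [shift_subst_X_zero]; exact hA,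
    by rw [shift_subst_X_zero]; exact h⟩

/-- A TERMINAL position is an exit up to free moves. -/
theorem exit₃_of_terminal {A : Fin d → MvPowerSeries (Fin 2) k} (hA : IsPos d A) (h : Terminal d A) : Exit₃ p d A :=
  exit₃_of_isExit hA (Or.inl (Or.inl h))

/-- The ZERO tuple is an exit up to free moves. -/
theorem exit₃_of_eq_zero {A : Fin d → MvPowerSeries (Fin 2) k} (hA : IsPos d A) (h : ∀ j : Fin d, A j = 0) : Exit₃ p d A :=
  exit₃_of_isExit hA (Or.inr h)

/-! ### `Exit₃` is invariant under re-centrings -/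

/-- A re-centring composed with an exit up to free moves is an exit up to free moves: `Exit₃ (shift d A φ) → Exit₃ A`. -/
theorem exit₃_of_exit₃_shift {A : Fin d → MvPowerSeries (Fin 2) k} {φ : MvPowerSeries (Fin 2) k} (hφ : constantCoeff φ = 0)
    (h : Exit₃ p d (shift d A φ)) : Exit₃ p d A := by
  obtain ⟨θ, φ₁, hθ0, hθdet, hφ₁, hpos, hex⟩ := h
  have hθs : HasSubst θ := hasSubst_of_constantCoeff_zero hθ0
  have hcomp : shift d (fun j => subst θ (shift d A φ j)) φ₁ = shift d (fun j => subst θ (A j)) (φ₁ + subst θ φ) := by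
    have hfun : (fun j => subst θ (shift d A φ j)) = shift d (fun j => subst θ (A j)) (subst θ φ) :=
      funext fun j => subst_shift hθs A φ j
    rw [hfun, shift_shift]
  refine ⟨θ, φ₁ + subst θ φ, hθ0, hθdet, ?_, hcomp ▸ hpos, hcomp ▸ hex⟩
  rw [map_add, hφ₁, constantCoeff_subst_eq_zero hθs hθ0 hφ, add_zero]

/-- `Exit₃` IS INVARIANT UNDER RE-CENTRINGS `y ↦ y + φ`, `φ(0) = 0`. -/
theorem exit₃_shift_iff {A : Fin d → MvPowerSeries (Fin 2) k} {φ : MvPowerSeries (Fin 2) k} (hφ : constantCoeff φ = 0) :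
    Exit₃ p d (shift d A φ) ↔ Exit₃ p d A := by
  refine ⟨exit₃_of_exit₃_shift hφ, fun h => ?_⟩
  have hback : shift d (shift d A φ) (-φ) = A := by rw [shift_shift, neg_add_cancel, WildMonic.shift_zero]
  exact exit₃_of_exit₃_shift (φ := -φ) (by rw [map_neg, hφ, neg_zero]) (by rw [hback]; exact h)

/-- Positions are invariant under re-centrings that keep them positions — bookkeeping form used with `exit₃_shift_iff`: from
`IsPos d (shift d A φ)` nothing about `A` follows in general, so the hands carry both facts; this lemma is the trivial direction
`shift` by `0`. -/
theorem isPos_shift_zero_iff {A : Fin d → MvPowerSeries (Fin 2) k} : IsPos d (shift d A 0) ↔ IsPos d A := by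
  rw [WildMonic.shift_zero]

/-! ### Exits from the point-set shapes of Lemma 9.1.3 -/

/-- THE SMALL-RESIDUAL SHAPE of the scaled Newton set gives `Terminal` (second disjunct). -/
theorem terminal_of_termSR_shape (A : Fin d → MvPowerSeries (Fin 2) k) (i : Fin 2) {m : ℕ} (hm : 0 < m)
    (h1 : ∀ Q ∈ newtonSet A, d.factorial * m ≤ Q i)
    (h2 : ∀ Q ∈ newtonSet A, Q i = d.factorial * m → 0 < Q (if i = 0 then 1 else 0))
    (h3 : ∃ Q ∈ newtonSet A, Q 0 + Q 1 < d.factorial * (m + 1)) : Terminal d A := by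
  obtain ⟨hdiv, j₁, g, hg, hord⟩ := termSR_data_of_newtonSet A i m h1 h2 h3
  exact Or.inr ⟨i, m, hm, hdiv, j₁, g, hg, hord⟩

/-- … hence `Exit₃` at a position [Per17 Lemma 9.1.3, small-residual branch, in game form]. -/
theorem exit₃_of_termSR_shape {A : Fin d → MvPowerSeries (Fin 2) k} (hA : IsPos d A) (i : Fin 2) {m : ℕ} (hm : 0 < m)
    (h1 : ∀ Q ∈ newtonSet A, d.factorial * m ≤ Q i)
    (h2 : ∀ Q ∈ newtonSet A, Q i = d.factorial * m → 0 < Q (if i = 0 then 1 else 0))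
    (h3 : ∃ Q ∈ newtonSet A, Q 0 + Q 1 < d.factorial * (m + 1)) : Exit₃ p d A :=
  exit₃_of_terminal hA (terminal_of_termSR_shape A i hm h1 h2 h3)

/-- THE MONOMIAL SHAPE of the scaled Newton set (`deltaL = alphaL = a`: the single vertex `(a, 0)` on the `x₁`-axis, scale `d!`), together
with the NON-SOLVABILITY of the vertex polynomial when `d! ∣ a`, gives `Terminal` (first disjunct, `N = d!`, `b = 0`). -/
theorem terminal_of_termMono_shape (A : Fin d → MvPowerSeries (Fin 2) k) (hne : (newtonSet A).Nonempty) {a : ℕ}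
    (hδ : deltaL (newtonSet A) = a) (hα : alphaL (newtonSet A) = a)
    (hiii : d.factorial ∣ a → ∀ μ : k, ∃ j : Fin d,
      coeff (Finsupp.single 0 ((d - (j : ℕ)) * a / d.factorial) + Finsupp.single 1 0) (A j) ≠
        (d.choose (j : ℕ) : k) * (-μ) ^ (d - (j : ℕ))) : Terminal d A := by
  obtain ⟨hi, j₀, β, hβ0, hβ1, hβ⟩ := termMono_data_of_newtonSet A hne hδ hα
  refine Or.inl ⟨d.factorial, a, 0, Nat.factorial_pos d, hi, ⟨j₀, β, hβ0, hβ1, hβ⟩, fun ha _ μ => ?_⟩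
  obtain ⟨j, hj⟩ := hiii ha μ
  refine ⟨j, ?_⟩
  rwa [mul_zero, Nat.zero_div]

/-- … hence `Exit₃` at a position [Per17 Lemma 9.1.3, monomial branch, in game form]. -/
theorem exit₃_of_termMono_shape {A : Fin d → MvPowerSeries (Fin 2) k} (hA : IsPos d A) (hne : (newtonSet A).Nonempty) {a : ℕ}
    (hδ : deltaL (newtonSet A) = a) (hα : alphaL (newtonSet A) = a)
    (hiii : d.factorial ∣ a → ∀ μ : k, ∃ j : Fin d,
      coeff (Finsupp.single 0 ((d - (j : ℕ)) * a / d.factorial) + Finsupp.single 1 0) (A j) ≠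
        (d.choose (j : ℕ) : k) * (-μ) ^ (d - (j : ℕ))) : Exit₃ p d A :=
  exit₃_of_terminal hA (terminal_of_termMono_shape A hne hδ hα hiii)

end WildMonic

end Summit.ResolutionOfSingularities.ResolutionOfSingularities.Theorems

end
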